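import Mathlib.MeasureTheory.Integral.Prod
import Mathlib.MeasureTheory.Constructions.Pi
import Literature.NumberTheory.Transcendental.KZCalculus
import HarnessLib

/-!
# Slices of integral representations over the first coordinate: Fubini and additivity

Theorems only (companion to `KZCalculus.lean`). An `(n+1)`-dimensional integral representation
`R : KZ.IntegralRep (n + 1)` (`ℚ`-semialgebraic domain `σ ⊆ ℝⁿ⁺¹`, absolutely integrable
`ℚ`-semialgebraic integrand `f`) is read as the family of its **slices** over the first coordinate
`z 0 = s`: the slice of the domain at `s` is `{x : ℝⁿ | vecCons s x ∈ σ}` and the slice integral is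
`∫ x in {x | vecCons s x ∈ σ}, f (vecCons s x)` — the expression inlined in the route
`ValuedFieldSpecialisation` of the summit `KontsevichZagierPeriods` (and named `KZ.sliceValue` in
`KZConstantTerm.lean`, which imports this file). Here, entirely from Mathlib's Fubini–Tonelli:

* `measurePreserving_vecCons`: `(s, x) ↦ vecCons s x` is a measure-preserving measurable
  embedding `ℝ × ℝⁿ → ℝⁿ⁺¹` (it is the inverse of `MeasurableEquiv.piFinSuccAbove _ 0`);
* `integral_integral_slice`: **Fubini**, `∫ s, ∫ x in σ_s, f (vecCons s x) = R.value`, and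
  `integrable_integral_slice`, `ae_integrableOn_slice` (a.e. slice is absolutely integrable),
  `ae_volume_slice_eq_zero` (a.e. slice of a null set is null);
* slice-wise additivity at a given `s` under the hypotheses of the KZ additivity moves on the
  total spaces plus slice integrability / slice-nullity at that `s`
  (`integral_slice_add_of_integrand`, `integral_slice_add_of_domain`), hence for almost every
  `s` (`ae_integral_slice_add_of_integrand`, `ae_integral_slice_add_of_domain`).

Almost-everywhere in `s` is the most the total-space hypotheses give (a null set in `ℝⁿ⁺¹` may
have finitely many non-null slices); statements about limits `s → 0⁺` of slice integrals need the
every-`s` versions.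

## References

* M. Kontsevich, D. Zagier, *Periods* (2001), §1.2 (rule (1), additivity; families of integrals).
  [cite: KontsevichZagier2001]
-/

noncomputable section

open MeasureTheory Set Filter
open scoped Topology

namespace Literature.NumberTheory.Transcendental

namespace KZ

variable {n : ℕ}

/-! ### The map `(s, x) ↦ vecCons s x` -/

/-- `x ↦ vecCons s x : ℝⁿ → ℝⁿ⁺¹` is measurable. [folklore] -/
theorem measurable_vecCons (s : ℝ) : Measurable fun x : Fin n → ℝ => Matrix.vecCons s x :=
  (continuous_const.matrixVecCons continuous_id :
    Continuous fun x : Fin n → ℝ => Matrix.vecCons s x).measurable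

/-- Each slice `{x | vecCons s x ∈ R.domain}` of the domain of an integral representation is
measurable. [cite: KontsevichZagier2001, §1.1] -/
theorem measurableSet_slice (R : IntegralRep (n + 1)) (s : ℝ) :
    MeasurableSet {x : Fin n → ℝ | Matrix.vecCons s x ∈ R.domain} :=
  measurable_vecCons s (IntegralRep.measurableSet_domain_holds R)

/-- The inverse of `MeasurableEquiv.piFinSuccAbove (fun _ => ℝ) 0 : ℝⁿ⁺¹ ≃ᵐ ℝ × ℝⁿ` is
`(s, x) ↦ vecCons s x`. [folklore] -/
theorem piFinSuccAbove_zero_symm_apply (p : ℝ × (Fin n → ℝ)) :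
    (MeasurableEquiv.piFinSuccAbove (fun _ : Fin (n + 1) => ℝ) 0).symm p =
      Matrix.vecCons p.1 p.2 := by
  simp [MeasurableEquiv.piFinSuccAbove, Matrix.vecCons, Fin.consEquiv]

/-- `(s, x) ↦ vecCons s x` is the inverse of `MeasurableEquiv.piFinSuccAbove (fun _ => ℝ) 0`, as
functions. [folklore] -/
theorem vecCons_eq_piFinSuccAbove_symm :
    (fun p : ℝ × (Fin n → ℝ) => Matrix.vecCons p.1 p.2) =
      ⇑(MeasurableEquiv.piFinSuccAbove (fun _ : Fin (n + 1) => ℝ) 0).symm :=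
  funext fun p => (piFinSuccAbove_zero_symm_apply p).symm

/-- `(s, x) ↦ vecCons s x : ℝ × ℝⁿ → ℝⁿ⁺¹` is a measurable embedding. [folklore] -/
theorem measurableEmbedding_vecCons :
    MeasurableEmbedding fun p : ℝ × (Fin n → ℝ) => Matrix.vecCons p.1 p.2 := by
  rw [vecCons_eq_piFinSuccAbove_symm]
  exact (MeasurableEquiv.piFinSuccAbove (fun _ : Fin (n + 1) => ℝ) 0).symm.measurableEmbedding

/-- `(s, x) ↦ vecCons s x` is measure preserving from `volume.prod volume` on `ℝ × ℝⁿ` to Lebesgue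
measure on `ℝⁿ⁺¹` (`MeasureTheory.volume_preserving_piFinSuccAbove`). [folklore] -/
theorem measurePreserving_vecCons :
    MeasurePreserving (fun p : ℝ × (Fin n → ℝ) => Matrix.vecCons p.1 p.2)
      ((volume : Measure ℝ).prod (volume : Measure (Fin n → ℝ))) volume := by
  rw [vecCons_eq_piFinSuccAbove_symm, ← Measure.volume_eq_prod]
  exact (volume_preserving_piFinSuccAbove (fun _ : Fin (n + 1) => ℝ) 0).symm _

/-- Change of variables `z = vecCons s x` in an integral over `ℝⁿ⁺¹`. [folklore] -/
theorem integral_comp_vecCons (g : (Fin (n + 1) → ℝ) → ℝ) :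
    ∫ p : ℝ × (Fin n → ℝ), g (Matrix.vecCons p.1 p.2)
        ∂((volume : Measure ℝ).prod (volume : Measure (Fin n → ℝ))) = ∫ z, g z :=
  measurePreserving_vecCons.integral_comp measurableEmbedding_vecCons g

/-! ### Fubini over the parameter coordinate -/

/-- The integrand of `R` extended by zero, composed with `(s, x) ↦ vecCons s x`, is integrable for
the product measure on `ℝ × ℝⁿ`. [cite: KontsevichZagier2001, §1.1] -/
theorem integrable_indicator_comp_vecCons (R : IntegralRep (n + 1)) :
    Integrable (fun p : ℝ × (Fin n → ℝ) => R.domain.indicator R.integrand (Matrix.vecCons p.1 p.2))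
      ((volume : Measure ℝ).prod (volume : Measure (Fin n → ℝ))) :=
  (measurePreserving_vecCons.integrable_comp_emb measurableEmbedding_vecCons).mpr
    ((integrable_indicator_iff (IntegralRep.measurableSet_domain_holds R)).mpr R.integrableOn)

/-- The slice at `s` of the integrand extended by zero integrates to the slice integral.
[cite: KontsevichZagier2001, §1.2] -/
theorem integral_indicator_comp_vecCons (R : IntegralRep (n + 1)) (s : ℝ) :
    ∫ x, R.domain.indicator R.integrand (Matrix.vecCons s x) =
      ∫ x in {x : Fin n → ℝ | Matrix.vecCons s x ∈ R.domain}, R.integrand (Matrix.vecCons s x) := by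
  rw [← integral_indicator (measurableSet_slice R s)]
  rfl

/-- **Fubini over the parameter coordinate**: the slice integrals of `R` integrate to `R.value`,
`∫ s, (∫ x in {x | vecCons s x ∈ R.domain}, R.integrand (vecCons s x)) = R.value`.
[cite: KontsevichZagier2001, §1.2] -/
theorem integral_integral_slice (R : IntegralRep (n + 1)) :
    ∫ s, ∫ x in {x : Fin n → ℝ | Matrix.vecCons s x ∈ R.domain}, R.integrand (Matrix.vecCons s x) =
      R.value := by
  calc ∫ s, ∫ x in {x : Fin n → ℝ | Matrix.vecCons s x ∈ R.domain}, R.integrand (Matrix.vecCons s x)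
      = ∫ s, ∫ x, R.domain.indicator R.integrand (Matrix.vecCons s x) := by
        simp_rw [integral_indicator_comp_vecCons]
    _ = ∫ p : ℝ × (Fin n → ℝ), R.domain.indicator R.integrand (Matrix.vecCons p.1 p.2)
          ∂((volume : Measure ℝ).prod (volume : Measure (Fin n → ℝ))) :=
        (integral_prod _ (integrable_indicator_comp_vecCons R)).symm
    _ = ∫ z, R.domain.indicator R.integrand z := integral_comp_vecCons _
    _ = R.value := integral_indicator (IntegralRep.measurableSet_domain_holds R)

/-- The slice integrals `s ↦ ∫ x in {x | vecCons s x ∈ R.domain}, R.integrand (vecCons s x)` form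
an integrable function of `s`. [cite: KontsevichZagier2001, §1.2] -/
theorem integrable_integral_slice (R : IntegralRep (n + 1)) :
    Integrable fun s : ℝ =>
      ∫ x in {x : Fin n → ℝ | Matrix.vecCons s x ∈ R.domain}, R.integrand (Matrix.vecCons s x) := by
  simp_rw [← integral_indicator_comp_vecCons]
  exact (integrable_indicator_comp_vecCons R).integral_prod_left

/-- Almost every slice of an integral representation is absolutely integrable.
[cite: KontsevichZagier2001, §1.1] -/
theorem ae_integrableOn_slice (R : IntegralRep (n + 1)) :
    ∀ᵐ s : ℝ, IntegrableOn (fun x => R.integrand (Matrix.vecCons s x))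
      {x : Fin n → ℝ | Matrix.vecCons s x ∈ R.domain} := by
  filter_upwards [(integrable_indicator_comp_vecCons R).prod_right_ae] with s hs
  exact (integrable_indicator_iff (μ := volume)
    (f := fun x => R.integrand (Matrix.vecCons s x)) (measurableSet_slice R s)).mp hs

/-- Almost every slice `{x | vecCons s x ∈ N}` of a Lebesgue-null set `N ⊆ ℝⁿ⁺¹` is Lebesgue-null
in `ℝⁿ`. [folklore] -/
theorem ae_volume_slice_eq_zero {N : Set (Fin (n + 1) → ℝ)} (hN : volume N = 0) :
    ∀ᵐ s : ℝ, volume {x : Fin n → ℝ | Matrix.vecCons s x ∈ N} = 0 := by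
  have h : ((volume : Measure ℝ).prod (volume : Measure (Fin n → ℝ)))
      ((fun p : ℝ × (Fin n → ℝ) => Matrix.vecCons p.1 p.2) ⁻¹' N) = 0 :=
    (measurePreserving_vecCons.measure_preimage (NullMeasurableSet.of_null hN)).trans hN
  filter_upwards [Measure.measure_ae_null_of_prod_null h] with s hs
  exact hs

/-! ### Slice-wise additivity -/

/-- **Slices of integrand additivity.** If `R`, `R₁`, `R₂` have the same domain and
`f = f₁ + f₂` on it (the data of `KZ.integrandAddRel`), then at every `s` at which the slices of
`R₁` and `R₂` are absolutely integrable, the slice integrals add.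
[cite: KontsevichZagier2001, §1.2 rule (1)] -/
theorem integral_slice_add_of_integrand {R R₁ R₂ : IntegralRep (n + 1)}
    (h₁ : R₁.domain = R.domain) (h₂ : R₂.domain = R.domain)
    (hadd : EqOn R.integrand (R₁.integrand + R₂.integrand) R.domain) {s : ℝ}
    (hi₁ : IntegrableOn (fun x => R₁.integrand (Matrix.vecCons s x))
      {x : Fin n → ℝ | Matrix.vecCons s x ∈ R₁.domain})
    (hi₂ : IntegrableOn (fun x => R₂.integrand (Matrix.vecCons s x))
      {x : Fin n → ℝ | Matrix.vecCons s x ∈ R₂.domain}) :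
    ∫ x in {x : Fin n → ℝ | Matrix.vecCons s x ∈ R.domain}, R.integrand (Matrix.vecCons s x) =
      (∫ x in {x : Fin n → ℝ | Matrix.vecCons s x ∈ R₁.domain}, R₁.integrand (Matrix.vecCons s x)) +
        ∫ x in {x : Fin n → ℝ | Matrix.vecCons s x ∈ R₂.domain},
          R₂.integrand (Matrix.vecCons s x) := by
  rw [h₁] at hi₁ ⊢
  rw [h₂] at hi₂ ⊢
  rw [← integral_add hi₁ hi₂]
  exact setIntegral_congr_fun (measurableSet_slice R s) fun x hx => hadd hx

/-- **Slices of domain additivity.** If `R.domain = R₁.domain ∪ R₂.domain` and the integrands of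
`R₁`, `R₂` agree with that of `R` on their domains (the data of `KZ.domainAddRel`), then at every
`s` at which the slices of `R₁.domain` and `R₂.domain` meet in a null set and the slice of `R` is
absolutely integrable, the slice integrals add. [cite: KontsevichZagier2001, §1.2 rule (1)] -/
theorem integral_slice_add_of_domain {R R₁ R₂ : IntegralRep (n + 1)}
    (hdom : R.domain = R₁.domain ∪ R₂.domain) (h₁ : EqOn R.integrand R₁.integrand R₁.domain)
    (h₂ : EqOn R.integrand R₂.integrand R₂.domain) {s : ℝ}
    (hnull : volume ({x : Fin n → ℝ | Matrix.vecCons s x ∈ R₁.domain} ∩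
      {x : Fin n → ℝ | Matrix.vecCons s x ∈ R₂.domain}) = 0)
    (hi : IntegrableOn (fun x => R.integrand (Matrix.vecCons s x))
      {x : Fin n → ℝ | Matrix.vecCons s x ∈ R.domain}) :
    ∫ x in {x : Fin n → ℝ | Matrix.vecCons s x ∈ R.domain}, R.integrand (Matrix.vecCons s x) =
      (∫ x in {x : Fin n → ℝ | Matrix.vecCons s x ∈ R₁.domain}, R₁.integrand (Matrix.vecCons s x)) +
        ∫ x in {x : Fin n → ℝ | Matrix.vecCons s x ∈ R₂.domain},
          R₂.integrand (Matrix.vecCons s x) := by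
  have hset : {x : Fin n → ℝ | Matrix.vecCons s x ∈ R.domain} =
      {x : Fin n → ℝ | Matrix.vecCons s x ∈ R₁.domain} ∪
        {x : Fin n → ℝ | Matrix.vecCons s x ∈ R₂.domain} := by
    ext x
    simp [hdom]
  rw [hset] at hi ⊢
  have hae : AEDisjoint volume {x : Fin n → ℝ | Matrix.vecCons s x ∈ R₁.domain}
      {x : Fin n → ℝ | Matrix.vecCons s x ∈ R₂.domain} := hnull
  rw [setIntegral_union₀ hae (measurableSet_slice R₂ s).nullMeasurableSet
      (hi.mono_set subset_union_left) (hi.mono_set subset_union_right),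
    setIntegral_congr_fun (measurableSet_slice R₁ s) fun x hx => h₁ hx,
    setIntegral_congr_fun (measurableSet_slice R₂ s) fun x hx => h₂ hx]

/-- Under the hypotheses of the integrand-additivity move on the total spaces, the slice
integrals add for almost every `s`. [cite: KontsevichZagier2001, §1.2 rule (1)] -/
theorem ae_integral_slice_add_of_integrand {R R₁ R₂ : IntegralRep (n + 1)}
    (h₁ : R₁.domain = R.domain) (h₂ : R₂.domain = R.domain)
    (hadd : EqOn R.integrand (R₁.integrand + R₂.integrand) R.domain) :
    ∀ᵐ s : ℝ,
      ∫ x in {x : Fin n → ℝ | Matrix.vecCons s x ∈ R.domain}, R.integrand (Matrix.vecCons s x) =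
        (∫ x in {x : Fin n → ℝ | Matrix.vecCons s x ∈ R₁.domain},
            R₁.integrand (Matrix.vecCons s x)) +
          ∫ x in {x : Fin n → ℝ | Matrix.vecCons s x ∈ R₂.domain},
            R₂.integrand (Matrix.vecCons s x) := by
  filter_upwards [ae_integrableOn_slice R₁, ae_integrableOn_slice R₂] with s hi₁ hi₂
  exact integral_slice_add_of_integrand h₁ h₂ hadd hi₁ hi₂

/-- Under the hypotheses of the domain-additivity move on the total spaces
(`volume (R₁.domain ∩ R₂.domain) = 0`), the slice integrals add for almost every `s`.
[cite: KontsevichZagier2001, §1.2 rule (1)] -/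
theorem ae_integral_slice_add_of_domain {R R₁ R₂ : IntegralRep (n + 1)}
    (hdom : R.domain = R₁.domain ∪ R₂.domain) (hnull : volume (R₁.domain ∩ R₂.domain) = 0)
    (h₁ : EqOn R.integrand R₁.integrand R₁.domain) (h₂ : EqOn R.integrand R₂.integrand R₂.domain) :
    ∀ᵐ s : ℝ,
      ∫ x in {x : Fin n → ℝ | Matrix.vecCons s x ∈ R.domain}, R.integrand (Matrix.vecCons s x) =
        (∫ x in {x : Fin n → ℝ | Matrix.vecCons s x ∈ R₁.domain},
            R₁.integrand (Matrix.vecCons s x)) +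
          ∫ x in {x : Fin n → ℝ | Matrix.vecCons s x ∈ R₂.domain},
            R₂.integrand (Matrix.vecCons s x) := by
  filter_upwards [ae_volume_slice_eq_zero hnull, ae_integrableOn_slice R] with s hs hi
  exact integral_slice_add_of_domain hdom h₁ h₂ hs hi

end KZ

end Literature.NumberTheory.Transcendental
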